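import Summits.PneNP.PneNP.Theorems.ConvexRankGatesConvexGateBlindExactLiftingTriangleLine

/-!
# The triangle instance: from the line model to ALL factorisations — supports must spread over Ω̃(t³) lines

Support file for crux `ConvexGateBlind` (stmt-PneNP-10680), line `xor-door-perfect-completeness`, open
stub `stub_exactLifting` (prover seat 0, session 20; memo ANALYSIS10 §1b; sequel of `…TriangleLine`).

The line-model bound `triangle_line_nmf_bound'` counts terms. Two upgrades:

* `triangle_line_nmf_bound_nonzero`: only the terms whose column factor is not identically zero count
  (re-index the non-zero terms).
* SPLITTING (`triangle_nmf_split_bound`). Take ANY non-negative factorisation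
  `M_t − εJ = ∑_{l<R} u_l ⊗ v_l + ∑_{j<q} a_j ⊗ b_j` (`ε > 0`, no support hypothesis at all) and any rule
  `o l w ∈ Fin 3` choosing, for each term and each triangle, one of the three junta lines through the triangle
  (`lineOf`). Splitting every `v_l` into its pieces on the chosen lines gives a line-model factorisation, so the
  number `N(o)` of NON-ZERO PIECES satisfies `t³ ≤ 4((⌊log₂ t⌋+1)(N(o) + 3t²(q+1)) + 6t²)`. With the best rule,
  `N = ∑_l lc(supp v_l)`, `lc(S)` = least number of junta lines covering `S`: in EVERY strict factorisation of the
  triangle matrix the column supports need `Ω(t³ / log t)` lines in total — `3t²` suffice at `ε = 0`.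
* SHADOWS (`triangle_nmf_shadow_bound`, registered form; rule `o ≡ 0`): the total size of the `(1,2)`-shadows
  `{(a,b) : ∃ d, v_l(a,b,d) ≠ 0}` of the column supports is at least `t³/(4(⌊log₂t⌋+1)) − 3t²(q+1) − O(t²/log t)`;
  e.g. a strict factorisation with `R = C t²` terms has average shadow `Ω(t / log t)` in each of the three
  orientations.
-/

set_option linter.dupNamespace false -- `Summit.PneNP.PneNP.…`: summit = sub-problem (D-0017)

namespace Summit.PneNP.PneNP.Theorems.XorDoor.TriLine

open Finset

noncomputable section

/-- **Only non-zero column factors count** in the line-model bound. -/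
theorem triangle_line_nmf_bound_nonzero (t R q : ℕ) (ht : 2 ≤ t) (ε : ℝ) (hε : 0 < ε)
    (u : Col t → Fin R → ℝ) (v : Fin R → Tri t → ℝ) (a : Col t → Fin q → ℝ) (b : Fin q → Tri t → ℝ)
    (hu : ∀ x l, 0 ≤ u x l) (hv : ∀ l w, 0 ≤ v l w) (ha : ∀ x j, 0 ≤ a x j) (hb : ∀ j w, 0 ≤ b j w)
    (hline : ∀ l, (∃ a₀ b₀ : Fin t, ∀ w, v l w ≠ 0 → w.1 = a₀ ∧ w.2.1 = b₀) ∨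
      (∃ a₀ d₀ : Fin t, ∀ w, v l w ≠ 0 → w.1 = a₀ ∧ w.2.2 = d₀) ∨
      (∃ b₀ d₀ : Fin t, ∀ w, v l w ≠ 0 → w.2.1 = b₀ ∧ w.2.2 = d₀))
    (hfact : ∀ x w, (monoCount x w : ℝ) - ε = ∑ l, u x l * v l w + ∑ j, a x j * b j w) :
    t ^ 3 ≤ 4 * ((Nat.log 2 t + 1) * (#(univ.filter fun l : Fin R => ∃ w, v l w ≠ 0) + 3 * t ^ 2 * (q + 1))
      + 6 * t ^ 2) := by
  classical
  set S : Finset (Fin R) := univ.filter fun l : Fin R => ∃ w, v l w ≠ 0 with hS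
  let e : Fin #S ≃ S := S.equivFin.symm
  refine triangle_line_nmf_bound' t #S q ht ε hε (fun x i => u x (e i)) (fun i => v (e i)) a b
    (fun x i => hu x _) (fun i w => hv _ w) ha hb (fun i => hline _) fun x w => ?_
  rw [hfact x w]
  congr 1
  have h1 : ∑ l, u x l * v l w = ∑ l ∈ S, u x l * v l w := by
    refine (sum_subset (subset_univ S) fun l _ hl => ?_).symm
    have h0 : v l w = 0 := by
      by_contra h0
      exact hl (by rw [hS]; exact mem_filter.2 ⟨mem_univ _, w, h0⟩)
    rw [h0, mul_zero]
  have h2 : ∑ l ∈ S, u x l * v l w = ∑ i : S, u x i * v i w := (sum_coe_sort S _).symm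
  have h3 : ∑ i : S, u x i * v i w = ∑ i : Fin #S, u x (e i) * v (e i) w :=
    (Equiv.sum_comp e (fun i : S => u x i * v i w)).symm
  rw [h1, h2, h3]

/-- The junta line of orientation `k ∈ Fin 3` through the triangle `w`:
`0 ↦ {(w₁,w₂,·)}`, `1 ↦ {(w₁,·,w₃)}`, `2 ↦ {(·,w₂,w₃)}`. -/
def lineOf {t : ℕ} (k : Fin 3) (w : Tri t) : Line t :=
  if k = 0 then Sum.inl (w.1, w.2.1) else if k = 1 then Sum.inr (Sum.inl (w.1, w.2.2))
    else Sum.inr (Sum.inr (w.2.1, w.2.2))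

/-- The piece of `v` on the line `L` under the rule `o`: the values of `v` at the triangles routed to `L`. -/
def piece {t : ℕ} (o : Tri t → Fin 3) (v : Tri t → ℝ) (L : Line t) (w : Tri t) : ℝ :=
  if lineOf (o w) w = L then v w else 0

/-- every piece is supported on its line -/
lemma piece_onLine {t : ℕ} (o : Tri t → Fin 3) (v : Tri t → ℝ) (L : Line t) :
    (∃ a₀ b₀ : Fin t, ∀ w, piece o v L w ≠ 0 → w.1 = a₀ ∧ w.2.1 = b₀) ∨
      (∃ a₀ d₀ : Fin t, ∀ w, piece o v L w ≠ 0 → w.1 = a₀ ∧ w.2.2 = d₀) ∨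
      (∃ b₀ d₀ : Fin t, ∀ w, piece o v L w ≠ 0 → w.2.1 = b₀ ∧ w.2.2 = d₀) := by
  have key : ∀ w, piece o v L w ≠ 0 → lineOf (o w) w = L := by
    intro w hw
    by_contra h
    exact hw (by simp [piece, h])
  rcases L with ⟨a₀, b₀⟩ | ⟨a₀, d₀⟩ | ⟨b₀, d₀⟩
  · refine Or.inl ⟨a₀, b₀, fun w hw => ?_⟩
    have h := key w hw
    unfold lineOf at h
    split_ifs at h
    all_goals simp_all
  · refine Or.inr (Or.inl ⟨a₀, d₀, fun w hw => ?_⟩)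
    have h := key w hw
    unfold lineOf at h
    split_ifs at h
    all_goals simp_all
  · refine Or.inr (Or.inr ⟨b₀, d₀, fun w hw => ?_⟩)
    have h := key w hw
    unfold lineOf at h
    split_ifs at h
    all_goals simp_all

/-- the pieces of `v` add up to `v` -/
lemma sum_piece {t : ℕ} (o : Tri t → Fin 3) (v : Tri t → ℝ) (w : Tri t) :
    ∑ L : Line t, piece o v L w = v w := by
  classical
  simp [piece, Finset.sum_ite_eq]

/-- **SPLITTING: the line bound for EVERY factorisation.** For any non-negative factorisation of `M_t − εJ`
(`ε > 0`, no support hypothesis) and any routing rule `o`, the number `N(o)` of non-zero pieces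
`(l, L)` satisfies `t³ ≤ 4((⌊log₂t⌋+1)(N(o) + 3t²(q+1)) + 6t²)`. -/
theorem triangle_nmf_split_bound (t R q : ℕ) (ht : 2 ≤ t) (ε : ℝ) (hε : 0 < ε)
    (u : Col t → Fin R → ℝ) (v : Fin R → Tri t → ℝ) (a : Col t → Fin q → ℝ) (b : Fin q → Tri t → ℝ)
    (hu : ∀ x l, 0 ≤ u x l) (hv : ∀ l w, 0 ≤ v l w) (ha : ∀ x j, 0 ≤ a x j) (hb : ∀ j w, 0 ≤ b j w)
    (hfact : ∀ x w, (monoCount x w : ℝ) - ε = ∑ l, u x l * v l w + ∑ j, a x j * b j w)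
    (o : Fin R → Tri t → Fin 3) :
    t ^ 3 ≤ 4 * ((Nat.log 2 t + 1)
      * (#(univ.filter fun p : Fin R × Line t => ∃ w, piece (o p.1) (v p.1) p.2 w ≠ 0) + 3 * t ^ 2 * (q + 1))
      + 6 * t ^ 2) := by
  classical
  -- index the pieces by `Fin K`
  set K := Fintype.card (Fin R × Line t) with hK
  let e : Fin K ≃ Fin R × Line t := (Fintype.equivFin (Fin R × Line t)).symm
  have h := triangle_line_nmf_bound_nonzero t K q ht ε hε (fun x k => u x (e k).1)
    (fun k => piece (o (e k).1) (v (e k).1) (e k).2) a b (fun x k => hu x _)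
    (fun k w => by unfold piece; split_ifs <;> [exact hv _ w; exact le_rfl]) ha hb
    (fun k => piece_onLine _ _ _) (fun x w => by
      rw [hfact x w]
      congr 1
      have h1 : ∑ k : Fin K, u x (e k).1 * piece (o (e k).1) (v (e k).1) (e k).2 w
          = ∑ p : Fin R × Line t, u x p.1 * piece (o p.1) (v p.1) p.2 w :=
        Equiv.sum_comp e (fun p : Fin R × Line t => u x p.1 * piece (o p.1) (v p.1) p.2 w)
      rw [h1, Fintype.sum_prod_type]
      refine sum_congr rfl fun l _ => ?_
      simp only [← mul_sum, sum_piece])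
  -- the two counts agree
  have hc : #(univ.filter fun k : Fin K => ∃ w, piece (o (e k).1) (v (e k).1) (e k).2 w ≠ 0)
      = #(univ.filter fun p : Fin R × Line t => ∃ w, piece (o p.1) (v p.1) p.2 w ≠ 0) := by
    rw [← Finset.card_map e.toEmbedding]
    congr 1
    ext p
    simp only [mem_map_equiv, mem_filter, mem_univ, true_and]
    constructor
    · rintro ⟨w, hw⟩; exact ⟨w, by simpa using hw⟩
    · rintro ⟨w, hw⟩; exact ⟨w, by simpa using hw⟩
  rw [hc] at h
  exact h

/-- **SHADOW BOUND for every factorisation** — registered sub-goal `triangle_nmf_shadow_bound` of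
stmt-PneNP-10680, verbatim signature with the instance inlined: for every non-negative factorisation of
`M_t − εJ` (`ε > 0`) into `R` rank-one terms plus `q` further terms, the total size of the `(1,2)`-shadows
`{(a,b) : ∃ d, v_l(a,b,d) ≠ 0}` of the `R` column supports is `N ≥ t³/(4(⌊log₂t⌋+1)) − 3t²(q+1) − O(t²/log t)`:
`t³ ≤ 4((⌊log₂t⌋+1)(N + 3t²(q+1)) + 6t²)`. (Split every column factor along the lines `{(a,b,·)}`.) -/
theorem triangle_nmf_shadow_bound :
    ∀ (t R q : ℕ), 2 ≤ t → ∀ (ε : ℝ), 0 < ε → ∀ (u : (Fin t → Bool) × (Fin t → Bool) × (Fin t → Bool) → Fin R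
    → ℝ) (v : Fin R → Fin t × Fin t × Fin t → ℝ) (a : (Fin t → Bool) × (Fin t → Bool) × (Fin t → Bool) → Fin q
    → ℝ) (b : Fin q → Fin t × Fin t × Fin t → ℝ), (∀ x l, 0 ≤ u x l) → (∀ l w, 0 ≤ v l w) → (∀ x j, 0 ≤ a x j)
    → (∀ j w, 0 ≤ b j w) → (∀ x w, (((if x.1 w.1 = x.2.1 w.2.1 then 1 else 0) + (if x.1 w.1 = x.2.2 w.2.2 then 1
    else 0) + (if x.2.1 w.2.1 = x.2.2 w.2.2 then 1 else 0) : ℕ) : ℝ) - ε = ∑ l, u x l * v l w + ∑ j, a x j * b j w)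
    → t ^ 3 ≤ 4 * ((Nat.log 2 t + 1) * ((Finset.univ.filter fun p : Fin R × (Fin t × Fin t) => ∃ d : Fin t,
    v p.1 (p.2.1, p.2.2, d) ≠ 0).card + 3 * t ^ 2 * (q + 1)) + 6 * t ^ 2) := by
  intro t R q ht ε hε u v a b hu hv ha hb hfact
  classical
  have h := triangle_nmf_split_bound t R q ht ε hε u v a b hu hv ha hb
    (fun x w => by simpa [monoCount] using hfact x w) (fun _ _ => 0)
  refine h.trans ?_
  -- with the constant rule `0` every non-zero piece lives on a line `{(a,b,·)}` meeting the support
  have hsub : (univ.filter fun p : Fin R × Line t => ∃ w, piece (fun _ => (0 : Fin 3)) (v p.1) p.2 w ≠ 0)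
      ⊆ (univ.filter fun p : Fin R × (Fin t × Fin t) => ∃ d : Fin t, v p.1 (p.2.1, p.2.2, d) ≠ 0).image
          fun p => (p.1, (Sum.inl p.2 : Line t)) := by
    rintro ⟨l, L⟩ hp
    simp only [mem_filter, mem_univ, true_and] at hp
    obtain ⟨w, hw⟩ := hp
    have hL : lineOf (0 : Fin 3) w = L := by
      by_contra h'
      exact hw (by simp [piece, h'])
    have hv0 : v l w ≠ 0 := by
      intro h0
      exact hw (by simp [piece, h0])
    simp only [lineOf, if_true] at hL
    refine mem_image.2 ⟨(l, (w.1, w.2.1)), ?_, ?_⟩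
    · simp only [mem_filter, mem_univ, true_and]
      exact ⟨w.2.2, hv0⟩
    · exact Prod.ext rfl hL
  have hcard := (card_le_card hsub).trans card_image_le
  have hmono : ∀ N N' : ℕ, N ≤ N' →
      4 * ((Nat.log 2 t + 1) * (N + 3 * t ^ 2 * (q + 1)) + 6 * t ^ 2)
        ≤ 4 * ((Nat.log 2 t + 1) * (N' + 3 * t ^ 2 * (q + 1)) + 6 * t ^ 2) := fun N N' hN => by
    gcongr
  exact hmono _ _ hcard

/-- **ANCHORED LINE MODEL.** If the triangle matrix itself factors as `M_t = ∑_{l<R} u_l ⊗ v_l + A ⊗ B` with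
all factors `≥ 0`, every `v_l` supported on one junta line and the ANCHOR `A ⊗ B` entrywise positive
(Hrubeš's strict / anchored form, cf. `exactLifting_iff_anchored`), then `t³ ≤ 4((⌊log₂t⌋+1)(R + 9t²) + 6t²)`:
writing `ε := (min A)(min B) > 0`, `A ⊗ B − εJ = (min A)·1 ⊗ (B − min B) + (A − min A) ⊗ B` is a sum of two
non-negative rank-one terms, and `triangle_line_nmf_bound'` applies with `q = 2`. -/
theorem triangle_anchored_line_bound :
    ∀ (t R : ℕ), 2 ≤ t → ∀ (u : Col t → Fin R → ℝ) (v : Fin R → Tri t → ℝ) (A : Col t → ℝ) (B : Tri t → ℝ),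
    (∀ x l, 0 ≤ u x l) → (∀ l w, 0 ≤ v l w) → (∀ x, 0 < A x) → (∀ w, 0 < B w) →
    (∀ l, (∃ a₀ b₀ : Fin t, ∀ w, v l w ≠ 0 → w.1 = a₀ ∧ w.2.1 = b₀) ∨
      (∃ a₀ d₀ : Fin t, ∀ w, v l w ≠ 0 → w.1 = a₀ ∧ w.2.2 = d₀) ∨
      (∃ b₀ d₀ : Fin t, ∀ w, v l w ≠ 0 → w.2.1 = b₀ ∧ w.2.2 = d₀)) →
    (∀ x w, (monoCount x w : ℝ) = ∑ l, u x l * v l w + A x * B w) →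
    t ^ 3 ≤ 4 * ((Nat.log 2 t + 1) * (R + 9 * t ^ 2) + 6 * t ^ 2) := by
  intro t R ht u v A B hu hv hA hB hline hfact
  classical
  have ht0 : 0 < t := by omega
  haveI : Nonempty (Fin t) := ⟨⟨0, ht0⟩⟩
  -- the minima of the anchor factors
  obtain ⟨x₀, -, hx₀⟩ := exists_min_image (univ : Finset (Col t)) A univ_nonempty
  obtain ⟨w₀, -, hw₀⟩ := exists_min_image (univ : Finset (Tri t)) B univ_nonempty
  set ε := A x₀ * B w₀ with hε
  have hεpos : 0 < ε := mul_pos (hA x₀) (hB w₀)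
  -- the two free terms
  let a : Col t → Fin 2 → ℝ := fun x j => if j = 0 then A x₀ else A x - A x₀
  let b : Fin 2 → Tri t → ℝ := fun j w => if j = 0 then B w - B w₀ else B w
  have ha : ∀ x j, 0 ≤ a x j := fun x j => by
    dsimp only [a]
    split_ifs
    · exact (hA x₀).le
    · linarith [hx₀ x (mem_univ x)]
  have hb : ∀ j w, 0 ≤ b j w := fun j w => by
    dsimp only [b]
    split_ifs
    · linarith [hw₀ w (mem_univ w)]
    · exact (hB w).le
  have h := triangle_line_nmf_bound' t R 2 ht ε hεpos u v a b hu hv ha hb hline fun x w => by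
    rw [hfact x w, Fin.sum_univ_two]
    simp only [a, b, if_true, if_false, one_ne_zero, hε]
    ring
  calc t ^ 3 ≤ 4 * ((Nat.log 2 t + 1) * (R + 3 * t ^ 2 * (2 + 1)) + 6 * t ^ 2) := h
    _ = 4 * ((Nat.log 2 t + 1) * (R + 9 * t ^ 2) + 6 * t ^ 2) := by ring

end

end Summit.PneNP.PneNP.Theorems.XorDoor.TriLine
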